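import Literature.NumberTheory.EllipticCurves.Sprung2017.SharpFlatPAdicLFunction
import Literature.NumberTheory.EllipticCurves.Rank1Residual.Predicates
import HarnessLib
import HarnessLib.Audit

/-!
# Sprung's chromatic non-vanishing conjecture (J. Number Theory 132 (2012), Conjecture 6.15 =
# Algebra Number Theory 11 (2017), Conjecture 4.12), case `η = 1`, `p` odd — an OPEN named
# conjecture, filed as an obligation node (`@[conjecture] def`), nothing asserted

HONEST FRAMING (cross-ladder LITERATURE-TYPING layer D-0088(4), cell `bsd-littype`, seat
`bsd-littype-11` g2; paper of the seat: Sprung, Adv. Math. 449 (2024) 109741, whose §3 "Zero-function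
avoidance" (p. 8) and Lemma 3.11 / Choice 3.12 (p. 16) are where this conjecture's openness is paid
for): an unproven conjecture is NOT Literature; it lives on the Summits side as an explicitly tagged
obligation node. This file states the conjecture AS PRINTED, restricted to the only case the tree's
vocabulary transcribes (trivial tame character `η = 1`, odd `p`, `f` the newform of an elliptic curve
`E/ℚ`), on the tree's REAL objects: Sprung's pair `(L♯, L♭) ∈ Λ²` is any pair with
`Literature.NumberTheory.EllipticCurves.Sprung2017.IsSprungPair f p (a_p E) L♯ L♭` (the Mazur–Tate
characterisation `θ_n ≡ −(u_n L♯ + v_n L♭) (mod ω_n)`, file `Sprung2017/SharpFlatPAdicLFunction.lean`;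
existence = Sprung 2017 Thm. 1.12, the tree fact `thm112_exists_isSprungPair`, PROVED in
`Sprung2017/SharpFlatPAdicLFunctionProofs.lean`; uniqueness at a supersingular prime PROVED in
`Sprung2017/SharpFlatPAdicLFunctionUniqueProofs.lean`). Nothing about any curve is asserted; no
theorem here claims the conjecture; typed ≠ proved ≠ endorsed. The file is a pure CONJECTURE LEAF
(only an `@[conjecture]` def): kernel edges live in the sibling `SprungChromaticNonvanishingEdges.lean`.
Placement (gen 4, 2026-08-27): next to `Supersingular/SharpFlatNonvanishing.lean`, whose docstring records
the open positive-analytic-rank case this node names (typer-fileable `Rank1Residual/`, as the cell's other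
conjecture leaves `SelmerCorankPConverse.lean`, `ManinConstantOne.lean`, `GreenbergMuConjecture.lean`).

## Sources (READ by this seat 2026-08-26; locators are store chunks `pNNNN:Lnn`)

* F. Sprung, *Iwasawa theory for elliptic curves at supersingular primes: A pair of main conjectures*,
  J. Number Theory **132** (2012) 1483–1506 [Sprung2012], p. 1498
  [corpus: paper:doi-10-1016-j-jnt-2011-11-003 p0016 L139–L163], verbatim:
  > **Proposition 6.14.** Let `η : Δ → ℤ_p^×` be any character. Then at least one of `L♯_p(E, η, X)`
  > and `L♭_p(E, η, X)` is a nonzero function. If `L(E, η, 1) ≠ 0`, then they are both nonzero. […]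
  > In view of Mazur's and Swinnerton-Dyer's conjecture in the ordinary case [MSD, Conjecture 1] and
  > the fact that neither `L♯_p(E, η, X)` nor `L♭_p(E, η, X)` vanish when `a_p = 0` (cf. [Pollack,
  > Corollary 5.11]), it seems reasonable to conjecture the following:
  > **Conjecture 6.15.** Let `E` be an elliptic curve, `p` be a prime of good supersingular
  > reduction, and `η : Δ → ℤ_p^×` be any character. Then `L♯_p(E, η, X)` and `L♭_p(E, η, X)` are both
  > nonzero functions.
  and p. 1499 L5: "Proposition 6.14 gives even more evidence for this conjecture via the fact that a
  positive proportion of elliptic curves has rank zero, cf. [BS]." Standing in §§2–6 of the source: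
  `E/ℚ`, `p` a prime of good supersingular reduction (`p ∣ a_p`, `p = 2` ALLOWED there), `Δ = Gal(ℚ(μ_{2p})/ℚ)`.
* F. Sprung, *On pairs of `p`-adic `L`-functions for weight-two modular forms*, Algebra Number Theory
  **11** (2017) 885–928 [Sprung2017], §4 after the table of special values
  [corpus: paper:arxiv-1601.00010 p0017 L49–L51], verbatim:
  > **Conjecture 4.12.** Let `f` be a modular form as above, and let `p` be a good supersingular
  > prime. When `p` is odd, `L̂♭_p(f, ω^i, T)` and `L♭_p(f, ω^i, T)` are not identically zero, and
  > `L̂♯_p(f, ω^i, T)` and `L♯_p(f, ω^i, T)` are not identically zero when `a_p ≠ 2`. […]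
  (for `f = f_E` and odd supersingular `p`, `p ∣ a_p` forces `a_p ≠ 2`, so at `i = 0` this is
  Conj. 6.15 with `η = 1`).
* Where it bites in the seat's paper, F. I. Sprung, Adv. Math. **449** (2024) 109741 [Sprung2024]:
  p. 8 L49–L56 "Zero-function avoidance: When `a_p ≠ 0`, we can only say that at least one of the four
  functions `L♯♯, L♯♭` etc. is nonzero. Thus, we are only guaranteed that one of the integral cohomology
  classes `Δ♯` and `Δ♭` is nonzero, unlike in the case `a_p = 0`, where both are nonzero"; p. 16
  Lemma 3.11 / Choice 3.12 ("we choose `• ∈ {♯, ♭}` and `K` so that both `L•` and `L•_K` are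
  non-zero"); and Sprung 2012 Thm. 7.14 / 7.16 / Main Conj. 7.21 are stated for "`∗ ∈ {♯, ♭}` so that
  `L∗_p(E, η, X) ≠ 0`" [corpus: paper:doi-10-1016-j-jnt-2011-11-003 p0022 L8–L10, L37–L38, p0023 L27].

STATUS (2026-08-26): OPEN as stated. What IS a theorem, all PROVED in the tree (nothing of it is
re-asserted here): Prop. 6.14 first sentence for every Sprung pair of the newform of an elliptic curve
with good reduction at `p` — `Sprung2017.IsSprungPair.ne_zero_or_ne_zero` (Rohrlich 1984, a tree
theorem); second sentence at an odd supersingular prime —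
`Summit.BirchSwinnertonDyer.Rank1Residual.Supersingular.sharp_ne_zero_and_flat_ne_zero_of_analyticRank_eq_zero`
(constant-term table, `Supersingular/SprungConstantTerm.lean`), so the conjecture below HOLDS on
`{p odd good supersingular} ∩ {r_an(E) = 0}` (`Supersingular/SharpFlatNonvanishing.lean`, whose
docstring records "In positive analytic rank the conjecture stays OPEN … nothing here claims it") and
its OPEN content is exactly the positive-analytic-rank case (kernel edge
`sprungChromaticNonvanishing_iff_posAnalyticRank` in the sibling file); at `a_p = 0` it is Pollack
2003 Cor. 5.11 (both `L^±` non-zero; the tree's `IsPollackPair` carries `L⁺ ≠ 0 ∧ L⁻ ≠ 0` and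
`Supersingular/SprungPollackConsistency.lean` identifies the pairs), so for elliptic curves over `ℚ`
the open case is `p = 3`, `a_3 = ±3` (class X8 of the residual cell), `ord_{s=1} L(E, s) ≥ 1`.

## Transcription (word for word → tree vocabulary) and faithfulness

* "`E` an elliptic curve", "`p` a prime of good supersingular reduction" — `W : WeierstrassCurve ℚ`
  with `[W.IsElliptic] [W.IsGloballyMinimal]` (minimal model: `a_p(E) = W.frobeniusTrace p` is read
  off the reduction of `W`), `Rank1Residual.GoodSS W p` (`=` good reduction at `p ∧ p ∣ a_p`).
* "`L♯_p(E, η, X)`, `L♭_p(E, η, X)`" at `η = 1` — any `Lsharp Lflat : IwasawaAlgebra p` with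
  `IsSprungPair f p (W.frobeniusTrace p) Lsharp Lflat` for the newform `f` of `E`
  (`IsNewformOf W f`, any level `N`; the predicate pins `N`), exactly the binders of the tree's
  Prop. 6.14 theorems (`sprung_prop614`). Sprung 2012 builds `L♯/♭` for the elliptic curve (§6,
  Def. 6.x via `𝓛og`); Sprung 2017 Thm. 1.12 / Cor. 4.4 for the form; the tree's `IsSprungPair` is
  the Mazur–Tate form of the latter with the sign fixed by the special-value table (module docstring
  of `SharpFlatPAdicLFunction.lean`; consistency PROVED in `Supersingular/SprungConstantTerm.lean`).
* "both nonzero functions" — `Lsharp ≠ 0 ∧ Lflat ≠ 0` in `Λ = ℤ_p⟦T⟧`.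
* RESTRICTIONS relative to print (the conjecture below is the printed one RESTRICTED, i.e. WEAKER as an
  assertion, never stronger): `p ≠ 2` (the tree's `IsSprungPair` is the odd-`p` transcription,
  `N = n + 1`; Sprung 2012 allows `p = 2`) and `η = 1` only (the branches `η = ω^i`, `i ≠ 0`, need
  twisted Mazur–Tate elements the tree does not have). -- TODO(general form): `η ≠ 1`, `p = 2`.

One declaration, `@[conjecture]` (OPEN obligation node). Consumers: the ideation cells (open-question
harvest of the typing layer); cell `bsd-ssimc` / route `SignedLowerHalves` crux `SprungLowerHalfAtThree`
and the residual cell's class X8, where Sprung's Thm. 7.14 / 7.16 / Main Conj. 7.21 are available for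
a colour `∗` only when `L^∗ ≠ 0` — granted this node, for BOTH colours at every X8 pair of positive
analytic rank.
-/

set_option autoImplicit false

noncomputable section

open scoped MatrixGroups ModularForm

open CongruenceSubgroup WeierstrassCurve Literature.NumberTheory.EllipticCurves
  Literature.NumberTheory.EllipticCurves.ModularForms
  Literature.NumberTheory.EllipticCurves.Rank1Residual
  Literature.NumberTheory.EllipticCurves.Sprung2017

namespace Summit.BirchSwinnertonDyer.Rank1Residual.Supersingular

/-- **Sprung's chromatic non-vanishing conjecture, `η = 1`, odd `p` (Sprung 2012 Conj. 6.15 =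
Sprung 2017 Conj. 4.12 at `i = 0`; OPEN — nothing asserted).** "Let `E` be an elliptic curve, `p` be
a prime of good supersingular reduction, and `η : Δ → ℤ_p^×` be any character. Then `L♯_p(E, η, X)`
and `L♭_p(E, η, X)` are both nonzero functions." Transcription (module docstring): for a globally
minimal elliptic `W/ℚ`, an ODD prime `p` of good supersingular reduction (`GoodSS W p`), the newform
`f` of `E` (`IsNewformOf W f`) and EVERY pair `(L♯, L♭) ∈ Λ²` with
`IsSprungPair f p (a_p E) L♯ L♭`: `L♯ ≠ 0 ∧ L♭ ≠ 0`. Known: `L♯ ≠ 0 ∨ L♭ ≠ 0` always, and both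
`≠ 0` when `ord_{s=1} L(E, s) = 0` (tree theorems `IsSprungPair.ne_zero_or_ne_zero`,
`sharp_ne_zero_and_flat_ne_zero_of_analyticRank_eq_zero`); OPEN in positive analytic rank (for
`E/ℚ`: `p = 3`, `a_3 = ±3`). An obligation node; the printed `p = 2` and `η ≠ 1` branches are not
transcribed. [cite: Sprung2012, Conj. 6.15 (p. 1498)] [cite: Sprung2017, Conj. 4.12 (§4)] -/
@[conjecture] def SprungChromaticNonvanishing : Prop :=
  ∀ (W : WeierstrassCurve ℚ) [W.IsElliptic] [W.IsGloballyMinimal] (p : ℕ) [Fact p.Prime],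
    p ≠ 2 → GoodSS W p →
    ∀ (N : ℕ) [NeZero N] (f : CuspForm (Gamma0 N) 2), IsNewformOf W f →
    ∀ (Lsharp Lflat : IwasawaAlgebra p), IsSprungPair f p (W.frobeniusTrace p) Lsharp Lflat →
      Lsharp ≠ 0 ∧ Lflat ≠ 0

end Summit.BirchSwinnertonDyer.Rank1Residual.Supersingular

end
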